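import Mathlib
import Literature.NumberTheory.LFunctions.BernoulliOneOdd
import Summits.HodgeConjecture.FermatCycles.HodgeFermatLemmaEMu

/-!
# THEOREM (μ even): `μ_T − μ_T′` is an even function on `ℤ/p` (`HodgeFermat/MuEven.lean`)

Tree copy (whole module) of the module `HodgeFermat/MuEven.lean` of the sibling cell's standalone package
`run/shared/lean/pub/pub-hodgefermat/lean/HodgeFermat/` (170 lines, sha256 `350571b2443cc7f8…`), source lines 31–170 (all).
Filed by cell `pub-hfermat`, seat prover-1 gen-0, on the COORDINATOR KEEPER RULING of 2026-08-25 (gem sweep H1: take the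
off-gate kernel theorem `thmFstar` — `HodgeFermat/DecodingFinal.lean:29` — through the gate); this file is one link of the
minimal import closure of `thmFstar`.  The source module's declarations are VERBATIM those of the cell record
`check/DecodingFinal_standalone.lean` (27 bodies, 454 223 B, sha256 dca6f17de93119a6…, hub `lean check` rc 0, 130.1 s; pub-hodgefermat `CERT.md` l.978, GATE HF-G32).
Deviations from the source module, exhaustively: the `import` lines (tree modules `Summits.HodgeConjecture.FermatCycles.
HodgeFermat*` instead of `HodgeFermat.*`); this module docstring; DEDUP (pre-empting the gate's `dedup.landed`, cf. the bounce of p397837): the source's `lemma odd_inv` (l.97–101) restates the landed `Literature.NumberTheory.LFunctions.BernoulliOneOdd.odd_inv` VERBATIM and is therefore DELETED; its use (source l.120) is byte-identical and resolves to the Literature lemma through the added line `open Literature.NumberTheory.LFunctions.BernoulliOneOdd (odd_inv)`. One-line docstring added (gate lint) to `three_isUnit`.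
Every other line — in particular every declaration's statement and proof — is byte-identical to the source.
HONEST FRAMING: explicit algebraic cycles for specific Hodge classes on Fermat/Delsarte varieties; residual open instances
listed; no claim on general Hodge.  (This file is arithmetic of CM types; it claims nothing about cycles.)

The source module's docstring (MuEven.lean l.3–29), verbatim:

## THEOREM (μ even): the residue-count function `μ_T − μ_T′` on `(ℤ/p)ˣ` is EVEN (HF-G31c, DPRIME §7.1)

A CHARACTER-FREE consequence of LEMMA E (`LemmaEMu.lemmaE_mu`, μ-part, `m₀ = 3`, all odd `ψ` mod a prime `p ≠ 3`).
For a triple `T` and `x ∈ ℤ/p` put (DPRIME §7.1)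

  `μ_T(x) = Σ_{a ∈ T, 3 ∤ a} ([a ≡ x] − [a ≡ 3x]) + Σ_{a ∈ T, 3 ∣ a} 2·[a/3 ≡ x]`     (`muEntry`, `muFun`, values in `ℤ`).

Its character transform at `ψ⁻¹` is the (E0) weight sum: `Σ_x μ_T(x) ψ⁻¹(x) = Σ_{a ∈ T} ê_a(ψ)` (`hat_muFun`; `ê = LemmaEMu.ehat`,
using `ψ⁻¹(3⁻¹ a) = ψ(3) ψ⁻¹(a)`).  LEMMA E says these agree for `T ∼ T′` at every ODD `ψ`; so `D = μ_T − μ_T′` has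
vanishing odd Fourier coefficients, and Fourier inversion on `(ℤ/p)ˣ` (Mathlib's orthogonality
`DirichletCharacter.sum_char_inv_mul_char_eq`, as in `LemmaWFourier.inversion`) gives (`even_of_hat_odd_eq_zero`)

* `mu_even (h0 : H0) (hp : p.Prime) (hp3 : p ≠ 3) … (hT : SameType (3 * p) (a, b, c) (a', b', c')) (x : ZMod p) :
  muFun (a, b, c) (-x) - muFun (a', b', c') (-x) = muFun (a, b, c) x - muFun (a', b', c') x`

— for two zero-sum triples mod `3p` with entries prime to `p` and the same CM type, `μ_T − μ_T′` is an EVEN function on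
`ℤ/p` (at `x = 0` both sides vanish trivially).  No character appears in the statement; `HodgeFermat/LemmaEMuFinal.lean`
removes `h0` (`HurwitzZero.hypH0`).  This is the first half of DPRIME §7.1 ("μ_T − μ_T′ even") at the prime levels
`m₁ = p`, in the kernel; the second half ("ν_T − ν_T′ odd") needs LEMMA E's ν-part for the characters ramified at 3 and
is not attempted here.  `μ_T = μ_T′` itself is FALSE in general (e.g. `p = 7`: `(1,1,19) ∼ (1,3,17)` at 21 has
`μ_T − μ_T′ = −[x ≡ 3] − [x ≡ 4]`, even and non-zero) — checked independently by `code/gen31/lemmaE_mu_scan.py`.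

LIGHT module (imports `LemmaEMu`); no `sorry`; no `decide`; axioms [propext, Classical.choice, Quot.sound] (hub record
`check/MuEven_standalone.lean`, 5 bodies; JSON under `results/gen31/local/lean/`).
NOT imported by the root `HodgeFermat.lean`.
-/

namespace HodgeFermat.KRFree.MuEven

open Finset HodgeFermat.KRFree.LemmaN HodgeFermat.KRFree.TwistedMoment HodgeFermat.KRFree.LemmaEMu
open Literature.NumberTheory.LFunctions.BernoulliOneOdd (odd_inv)

variable {p : ℕ}

/-- the μ-weight of one entry `a` as an integer function on `ℤ/p`: `[a ≡ x] − [a ≡ 3x]` if `3 ∤ a`, `2·[a/3 ≡ x]` if `3 ∣ a` -/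
def muEntry (a : ℕ) (x : ZMod p) : ℤ :=
  if 3 ∣ a then (if ((a / 3 : ℕ) : ZMod p) = x then 2 else 0)
  else (if ((a : ℕ) : ZMod p) = x then 1 else 0) - (if ((a : ℕ) : ZMod p) = 3 * x then 1 else 0)

/-- `μ_T(x)` of DPRIME §7.1 for a triple `T` -/
def muFun (T : ℕ × ℕ × ℕ) (x : ZMod p) : ℤ := muEntry T.1 x + muEntry T.2.1 x + muEntry T.2.2 x

/-- `3` is a unit of `ZMod p` for a prime `p ≠ 3` -/
lemma three_isUnit [NeZero p] (hp : p.Prime) (hp3 : p ≠ 3) : IsUnit (3 : ZMod p) := by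
  have h : Nat.Coprime 3 p := (Nat.coprime_primes Nat.prime_three hp).mpr (Ne.symm hp3)
  have hu := (ZMod.unitOfCoprime 3 h).isUnit
  rw [ZMod.coe_unitOfCoprime, Nat.cast_ofNat] at hu
  exact hu

section transform

variable [NeZero p]

/-- `Σ_x μ_a(x)·ψ⁻¹(x) = ê_a(ψ)` for one entry -/
lemma hat_muEntry (hp : p.Prime) (hp3 : p ≠ 3) (ψ : DirichletCharacter ℂ p) (a : ℕ) :
    ∑ x : ZMod p, (muEntry a x : ℂ) * ψ⁻¹ x = ehat ψ a := by
  unfold muEntry ehat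
  by_cases h3 : 3 ∣ a
  · simp only [h3, if_true]
    push_cast
    simp only [ite_mul, zero_mul, Finset.sum_ite_eq, Finset.mem_univ, if_true]
  · simp only [h3, if_false]
    push_cast
    simp only [sub_mul, ite_mul, one_mul, zero_mul, Finset.sum_sub_distrib, Finset.sum_ite_eq, Finset.mem_univ,
      if_true]
    obtain ⟨t, ht⟩ := three_isUnit hp hp3
    have hsum : ∑ x : ZMod p, (if ((a : ℕ) : ZMod p) = 3 * x then ψ⁻¹ x else 0)
        = ψ (3 : ZMod p) * ψ⁻¹ ((a : ℕ) : ZMod p) := by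
      have key : ∀ x : ZMod p,
          (((a : ℕ) : ZMod p) = 3 * x) ↔ (((t⁻¹ : (ZMod p)ˣ) : ZMod p) * ((a : ℕ) : ZMod p) = x) := by
        intro x
        constructor
        · intro h; rw [h, ← mul_assoc, ← ht, Units.inv_mul, one_mul]
        · intro h; rw [← h, ← mul_assoc, ← ht, Units.mul_inv, one_mul]
      simp_rw [key]
      rw [Finset.sum_ite_eq, if_pos (Finset.mem_univ _), map_mul]
      congr 1
      rw [MulChar.inv_apply, Ring.inverse_unit, inv_inv, ht]
    rw [hsum]

/-- `Σ_x μ_T(x)·ψ⁻¹(x) = Σ_{a ∈ T} ê_a(ψ)` -/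
lemma hat_muFun (hp : p.Prime) (hp3 : p ≠ 3) (ψ : DirichletCharacter ℂ p) (a b c : ℕ) :
    ∑ x : ZMod p, (muFun (a, b, c) x : ℂ) * ψ⁻¹ x = ehat ψ a + ehat ψ b + ehat ψ c := by
  simp only [muFun, Int.cast_add, add_mul, Finset.sum_add_distrib, hat_muEntry hp hp3]

/-- LEMMA E in transform form: the odd Fourier coefficients of `μ_T − μ_T′` vanish (from H0). -/
theorem hat_diff_eq_zero (h0 : H0) (hp : p.Prime) (hp3 : p ≠ 3) (ψ : DirichletCharacter ℂ p) (hψ : ψ.Odd)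
    {a b c a' b' c' : ℕ} (hs : 3 * p ∣ a + b + c) (hs' : 3 * p ∣ a' + b' + c')
    (ha : Nat.Coprime a p) (hb : Nat.Coprime b p) (hc : Nat.Coprime c p)
    (ha' : Nat.Coprime a' p) (hb' : Nat.Coprime b' p) (hc' : Nat.Coprime c' p)
    (hT : SameType (3 * p) (a, b, c) (a', b', c')) :
    ∑ x : ZMod p, ((muFun (a, b, c) x - muFun (a', b', c') x : ℤ) : ℂ) * ψ⁻¹ x = 0 := by
  have h := lemmaE_mu h0 hp hp3 ψ hψ hs hs' ha hb hc ha' hb' hc' hT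
  simp only [Int.cast_sub, sub_mul, Finset.sum_sub_distrib, hat_muFun hp hp3, h, sub_self]


/-- Fourier inversion on `(ℤ/p)ˣ`: a function on `ℤ/p` all of whose coefficients `Σ_x F(x) ψ⁻¹(x)` at ODD characters
`ψ` vanish is EVEN on the units. -/
theorem even_of_hat_odd_eq_zero (F : ZMod p → ℂ)
    (hF : ∀ ψ : DirichletCharacter ℂ p, ψ.Odd → ∑ x : ZMod p, F x * ψ⁻¹ x = 0) (u : (ZMod p)ˣ) :
    F (-(u : ZMod p)) = F u := by
  -- every coefficient of `G(x) = F(x) − F(−x)` vanishes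
  have hG : ∀ χ : DirichletCharacter ℂ p, ∑ x : ZMod p, (F x - F (-x)) * χ x = 0 := by
    intro χ
    have hneg : ∑ x : ZMod p, F (-x) * χ x = χ (-1) * ∑ x : ZMod p, F x * χ x := by
      rw [show ∑ x : ZMod p, F (-x) * χ x = ∑ x : ZMod p, F x * χ (-x) from
        Fintype.sum_equiv (Equiv.neg (ZMod p)) _ _ (fun x => by simp), Finset.mul_sum]
      refine Finset.sum_congr rfl (fun x _ => ?_)
      rw [neg_eq_neg_one_mul x, map_mul]
      ring
    rw [Finset.sum_congr rfl (fun x _ => sub_mul (F x) (F (-x)) (χ x)), Finset.sum_sub_distrib, hneg]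
    rcases χ.even_or_odd with he | ho
    · rw [he]; ring
    · have h1 := hF χ⁻¹ (odd_inv ho)
      rw [inv_inv] at h1
      rw [ho, h1]; ring
  -- inversion at the unit `u`
  have hu : IsUnit (u : ZMod p) := Units.isUnit u
  have hinv : ∑ χ : DirichletCharacter ℂ p, χ ((u : ZMod p)⁻¹) * ∑ x : ZMod p, (F x - F (-x)) * χ x
      = (p.totient : ℂ) * (F u - F (-(u : ZMod p))) := by
    calc ∑ χ : DirichletCharacter ℂ p, χ ((u : ZMod p)⁻¹) * ∑ x : ZMod p, (F x - F (-x)) * χ x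
        = ∑ χ : DirichletCharacter ℂ p, ∑ x : ZMod p, (F x - F (-x)) * (χ ((u : ZMod p)⁻¹) * χ x) := by
            refine Finset.sum_congr rfl (fun χ _ => ?_)
            rw [Finset.mul_sum]
            exact Finset.sum_congr rfl (fun x _ => by ring)
      _ = ∑ x : ZMod p, (F x - F (-x)) * ∑ χ : DirichletCharacter ℂ p, χ ((u : ZMod p)⁻¹) * χ x := by
            rw [Finset.sum_comm]
            exact Finset.sum_congr rfl (fun x _ => by rw [Finset.mul_sum])
      _ = ∑ x : ZMod p, (F x - F (-x)) * (if (u : ZMod p) = x then (p.totient : ℂ) else 0) := by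
            refine Finset.sum_congr rfl (fun x _ => ?_)
            rw [DirichletCharacter.sum_char_inv_mul_char_eq ℂ hu x]
      _ = (p.totient : ℂ) * (F u - F (-(u : ZMod p))) := by
            simp only [mul_ite, mul_zero]
            rw [Finset.sum_ite_eq]
            simp [mul_comm]
  have hzero : (p.totient : ℂ) * (F u - F (-(u : ZMod p))) = 0 := by
    rw [← hinv]
    exact Finset.sum_eq_zero (fun χ _ => by rw [hG χ, mul_zero])
  have hφ : (p.totient : ℂ) ≠ 0 := Nat.cast_ne_zero.mpr (Nat.totient_pos.mpr (NeZero.pos p)).ne'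
  have h2 := (mul_eq_zero.mp hzero).resolve_left hφ
  linear_combination -h2

end transform

/-- **THEOREM (μ even; from H0).**  For a prime `p ≠ 3` and two zero-sum triples mod `3p` with entries prime to `p`
and the same CM type, the integer function `μ_T − μ_T′` on `ℤ/p` is EVEN: `D(−x) = D(x)`.  (Character-free; DPRIME
§7.1, first half, at prime levels.) -/
theorem mu_even (h0 : H0) (hp : p.Prime) (hp3 : p ≠ 3)
    {a b c a' b' c' : ℕ} (hs : 3 * p ∣ a + b + c) (hs' : 3 * p ∣ a' + b' + c')
    (ha : Nat.Coprime a p) (hb : Nat.Coprime b p) (hc : Nat.Coprime c p)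
    (ha' : Nat.Coprime a' p) (hb' : Nat.Coprime b' p) (hc' : Nat.Coprime c' p)
    (hT : SameType (3 * p) (a, b, c) (a', b', c')) (x : ZMod p) :
    muFun (a, b, c) (-x) - muFun (a', b', c') (-x) = muFun (a, b, c) x - muFun (a', b', c') x := by
  haveI : NeZero p := ⟨hp.ne_zero⟩
  by_cases hx : x = 0
  · subst hx
    rw [neg_zero]
  · haveI : Fact p.Prime := ⟨hp⟩
    obtain ⟨u, rfl⟩ := isUnit_iff_ne_zero.mpr hx
    have key := even_of_hat_odd_eq_zero (fun y => ((muFun (a, b, c) y - muFun (a', b', c') y : ℤ) : ℂ))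
      (fun ψ hψ => hat_diff_eq_zero h0 hp hp3 ψ hψ hs hs' ha hb hc ha' hb' hc' hT) u
    exact_mod_cast key

end HodgeFermat.KRFree.MuEven
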